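import Mathlib.Analysis.Complex.Convex
import Mathlib.Analysis.Convex.Topology
import Mathlib.Topology.UniformSpace.HeineCantor
import Literature.Probability.LatticeModels.IsingLimitLawLaplace
import Literature.Analysis.Complex.Hurwitz
import HarnessLib

/-!
# Lee–Yang for non-negative weights and for Ising limit laws (discharging two named facts)

Trunk T-STATMECH (`Literature/Probability/LatticeModels`), companion of `IsingLimitLaw.lean`.

* `lee_yang_ising_of_finite` — the named fact `lee_yang_ising` (Lee–Yang circle theorem for the
  weighted partition function `Z(z) = Σ_s e^{Σ Jᵢⱼ sᵢ sⱼ + z Σ wᵢ sᵢ}`, couplings `J ≥ 0`, weights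
  `w ≥ 0`, ZERO weights allowed) follows from the strictly-positive-weight case
  (`lee_yang_ising_of_pos`, itself a theorem from the tree's fact `lee_yang_circle_theorem_finite`)
  by Hurwitz's theorem in the vanishing extra weight `ε → 0⁺` (`wᵢ + ε > 0`): the partition
  functions converge locally uniformly (joint continuity in `(ε, z)`), are zero-free on the open
  right half plane, and the limit is not identically zero there (`Re Z(x) ≥ Z(0) > 0` for real `x`,
  by the spin-flip symmetry `Z(-z) = Z(z)`).
* `hasLeeYangProperty_of_isIsingLimitLaw_of_lee_yang_ising` — the named fact
  `hasLeeYangProperty_of_isIsingLimitLaw` (Newman 1974, Thm. 3: Ising limit laws have the Lee–Yang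
  property) follows from `lee_yang_ising`: along a witness sequence the Laplace transforms are
  entire, zero-free off the imaginary axis, converge locally uniformly
  (`IsingLimitLawLaplace.lean`), and have real part `≥ 1` at real points; Hurwitz on each open
  half plane.
* `hasLeeYangProperty_of_isIsingLimitLaw_of_finite` — hence both named facts of `IsingLimitLaw.lean`
  used by route RiemannHypothesis/LeeYang reduce to the single finite statement
  `lee_yang_circle_theorem_finite` (Lee–Yang 1952, App. II).

## References

* T. D. Lee, C. N. Yang, Phys. Rev. 87 (1952) 410, Appendix II.
* E. H. Lieb, A. D. Sokal, CMP 80 (1981) 153–179, §3 (fields in the closed half plane).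
* C. M. Newman, CPAM 27 (1974) 143–159, Thm. 3 (limits of Lee–Yang measures).
* J. B. Conway, *Functions of one complex variable I*, VII.2.5 (Hurwitz).
-/

noncomputable section

open MeasureTheory Filter Topology Complex Set Metric

namespace Literature.Probability.LatticeModels

/-! ### Elementary facts on the finite partition function -/

section Finite

variable {n : ℕ}

/-- `Z(z)` is an entire function of the field `z` (a finite sum of exponentials). [folklore] -/
theorem differentiable_isingFieldPartition (J : Fin n → Fin n → ℝ) (w : Fin n → ℝ) :
    Differentiable ℂ (isingFieldPartition J w) := by
  unfold isingFieldPartition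
  fun_prop

/-- For a real field `x`, `Re Z(x) ≥ Z(0)`: by the spin flip, `2 Z(x) = Σ_s B_s (e^{x M_s} + e^{-x M_s})`
and `e^{a} + e^{-a} ≥ 2`. [folklore] -/
theorem isingPairPartition_le_re_isingFieldPartition (J : Fin n → Fin n → ℝ) (w : Fin n → ℝ)
    (x : ℝ) : isingPairPartition J ≤ (isingFieldPartition J w x).re := by
  have hsymm := isingFieldPartition_neg J w x
  have h2 : 2 * (isingFieldPartition J w x).re =
      (isingFieldPartition J w x).re + (isingFieldPartition J w (-(x : ℂ))).re := by
    rw [hsymm]; ring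
  have hsum : (isingFieldPartition J w x).re + (isingFieldPartition J w (-(x : ℂ))).re =
      ∑ s : Fin n → Bool, isingBoltzmann J s *
        (Real.exp (x * weightedMagnetization w s) + Real.exp (-(x * weightedMagnetization w s))) := by
    unfold isingFieldPartition
    rw [Complex.re_sum, Complex.re_sum, ← Finset.sum_add_distrib]
    refine Finset.sum_congr rfl fun s _ => ?_
    have e1 : (x : ℂ) * (weightedMagnetization w s : ℂ) = ((x * weightedMagnetization w s : ℝ) : ℂ) := by
      push_cast; ring
    have e2 : -(x : ℂ) * (weightedMagnetization w s : ℂ) =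
        ((-(x * weightedMagnetization w s) : ℝ) : ℂ) := by
      push_cast; ring
    rw [e1, e2, ← Complex.ofReal_exp, ← Complex.ofReal_exp, ← Complex.ofReal_mul,
      ← Complex.ofReal_mul, Complex.ofReal_re, Complex.ofReal_re]
    ring
  have hge : ∀ s : Fin n → Bool, 2 * isingBoltzmann J s ≤ isingBoltzmann J s *
      (Real.exp (x * weightedMagnetization w s) + Real.exp (-(x * weightedMagnetization w s))) := by
    intro s
    have h1 := Real.add_one_le_exp (x * weightedMagnetization w s)
    have h2 := Real.add_one_le_exp (-(x * weightedMagnetization w s))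
    have hB := (isingBoltzmann_pos J s).le
    nlinarith
  have : 2 * isingPairPartition J ≤ 2 * (isingFieldPartition J w x).re := by
    rw [h2, hsum, isingPairPartition, Finset.mul_sum]
    exact Finset.sum_le_sum fun s _ => hge s
  linarith

/-- For a real field `x`, `Z(x) ≠ 0` (indeed `Re Z(x) ≥ Z(0) > 0`). [folklore] -/
theorem isingFieldPartition_ofReal_ne_zero (J : Fin n → Fin n → ℝ) (w : Fin n → ℝ) (x : ℝ) :
    isingFieldPartition J w x ≠ 0 := by
  intro h
  have := isingPairPartition_le_re_isingFieldPartition J w x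
  rw [h, Complex.zero_re] at this
  exact absurd this (not_le.2 (isingPairPartition_pos J))

/-- Shifting all weights by `ε` multiplies each term by `e^{z ε Σᵢ sᵢ}`; in particular the
partition function is jointly continuous in `(ε, z)`. [folklore] -/
theorem continuous_isingFieldPartition_add (J : Fin n → Fin n → ℝ) (w : Fin n → ℝ) :
    Continuous fun p : ℝ × ℂ => isingFieldPartition J (fun i => w i + p.1) p.2 := by
  unfold isingFieldPartition weightedMagnetization
  fun_prop

/-- For a real field `x`, the Laplace transform of a magnetization law has real part `≥ 1`
(`Re Z(x) ≥ Z(0)`). [folklore] -/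
theorem one_le_re_integral_cexp_isingMagnetizationLaw (J : Fin n → Fin n → ℝ)
    (w : Fin n → ℝ) (x : ℝ) :
    1 ≤ (∫ u, cexp (x * u) ∂(isingMagnetizationLaw n J w : Measure ℝ)).re := by
  rw [integral_exp_isingMagnetizationLaw, Complex.div_ofReal_re,
    le_div_iff₀ (isingPairPartition_pos J), one_mul]
  exact isingPairPartition_le_re_isingFieldPartition J w x

end Finite

/-! ### Lee–Yang with zero weights allowed: `lee_yang_ising` from the finite circle theorem -/

/-- **Lee–Yang circle theorem with non-negative weights** (discharge of the named fact
`lee_yang_ising` from `lee_yang_circle_theorem_finite`): for `J ≥ 0`, `w ≥ 0` and `Re z ≠ 0`,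
`Z(z) ≠ 0`. Proof: for `ε > 0` the weights `wᵢ + ε` are positive, so `Z_ε` is zero-free off the
axis (`lee_yang_ising_of_pos`); `Z_ε → Z` locally uniformly as `ε → 0⁺` (joint continuity), and `Z`
is not identically zero on the half plane (`Re Z(1) ≥ Z(0) > 0`), so Hurwitz's theorem applies; the
left half plane follows from `Z(-z) = Z(z)`. [Lieb–Sokal 1981, §3; Lee–Yang 1952, App. II]
[cite: LiebSokal1981, §3] -/
theorem lee_yang_ising_of_finite (h : lee_yang_circle_theorem_finite) : lee_yang_ising := by
  intro n J w hJ hw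
  -- Step 1: zero-freeness on the open right half plane, by Hurwitz.
  have key : ∀ z : ℂ, 0 < z.re → isingFieldPartition J w z ≠ 0 := by
    set U : Set ℂ := {z : ℂ | 0 < z.re} with hU
    -- the family `ε ↦ Z_{w + ε}` and its limit
    set F : ℝ → ℂ → ℂ := fun ε z => isingFieldPartition J (fun i => w i + ε) z with hF
    have hF0 : F 0 = isingFieldPartition J w := by
      funext z; simp [hF]
    have hcont : Continuous ↿F := continuous_isingFieldPartition_add J w
    -- locally uniform convergence on `U` (indeed on `ℂ`) as `ε → 0`
    have hunif : ∀ K : Set ℂ, IsCompact K → TendstoUniformlyOn F (F 0) (𝓝[>] (0 : ℝ)) K := by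
      intro K hK
      haveI : CompactSpace K := isCompact_iff_compactSpace.1 hK
      have hc : Continuous ↿(fun ε (k : K) => F ε k) := by
        change Continuous fun p : ℝ × K => F p.1 p.2
        exact hcont.comp (continuous_fst.prodMk (continuous_subtype_val.comp continuous_snd))
      have hT : TendstoUniformly (fun ε (k : K) => F ε k) (fun k : K => F 0 k) (𝓝 (0 : ℝ)) :=
        Continuous.tendstoUniformly (fun ε (k : K) => F ε k) hc 0
      have hT' : TendstoUniformly (fun ε (k : K) => F ε k) (fun k : K => F 0 k) (𝓝[>] (0 : ℝ)) :=
        fun u hu => (hT u hu).filter_mono nhdsWithin_le_nhds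
      rw [tendstoUniformlyOn_iff_tendstoUniformly_comp_coe]
      exact hT'
    have hloc : TendstoLocallyUniformlyOn F (F 0) (𝓝[>] (0 : ℝ)) U :=
      (tendstoLocallyUniformlyOn_iff_forall_isCompact (isOpen_lt continuous_const Complex.continuous_re)).2
        fun K _ hK => hunif K hK
    have hdiff : ∀ᶠ ε in 𝓝[>] (0 : ℝ), DifferentiableOn ℂ (F ε) U :=
      Eventually.of_forall fun ε => (differentiable_isingFieldPartition J _).differentiableOn
    have hne : ∃ᶠ ε in 𝓝[>] (0 : ℝ), ∀ z ∈ U, F ε z ≠ 0 := by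
      refine Eventually.frequently ?_
      filter_upwards [self_mem_nhdsWithin] with ε (hε : 0 < ε) z (hz : 0 < z.re)
      exact lee_yang_ising_of_pos h hJ (fun i => by linarith [hw i]) hz.ne'
    rcases Complex.hurwitz_eqOn_zero_or_forall_ne_zero (isOpen_lt continuous_const Complex.continuous_re)
      (convex_halfSpace_re_gt 0).isPreconnected hdiff
      hloc hne with hzero | hgood
    · exfalso
      have h1 : (1 : ℂ) ∈ U := by simp [hU]
      have := hzero h1
      rw [hF0, Pi.zero_apply] at this
      exact isingFieldPartition_ofReal_ne_zero J w 1 (by exact_mod_cast this)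
    · intro z hz
      have := hgood z hz
      rwa [hF0] at this
  -- Step 2: the left half plane by the spin flip.
  intro z hz
  rcases lt_or_gt_of_ne hz with hlt | hgt
  · rw [← isingFieldPartition_neg]
    exact key (-z) (by rw [Complex.neg_re]; linarith)
  · exact key z hgt


/-! ### Newman's closure theorem: Ising limit laws have the Lee–Yang property -/

/-- **Lee–Yang is closed under Ising limits** (discharge of the named fact
`hasLeeYangProperty_of_isIsingLimitLaw` from `lee_yang_ising`; Newman 1974, Thm. 3 / Lieb–Sokal
1981, §2): along a witness sequence the Laplace transforms `∫ e^{zu} dν_k` are entire, zero-free off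
the imaginary axis (Lee–Yang for finite ferromagnets), converge locally uniformly to `∫ e^{zu} dν`
(uniform `e^{u²}`-moment bounds), and the limit has real part `≥ 1` at real `z`; Hurwitz's theorem
on each open half plane gives the Lee–Yang property of `ν`. [cite: Newman1974, Thm. 3] -/
theorem hasLeeYangProperty_of_isIsingLimitLaw_of_lee_yang_ising (hLY : lee_yang_ising) :
    hasLeeYangProperty_of_isIsingLimitLaw := by
  rintro ν ⟨n, J, w, hJ, hw, hlim, hmom⟩
  obtain ⟨C, hC⟩ := hmom 1
  have hC' : ∀ k, ∫ u, Real.exp (u ^ 2) ∂(isingMagnetizationLaw (n k) (J k) (w k) : Measure ℝ) ≤ C :=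
    fun k => by simpa only [one_mul] using hC k
  have hint : ∀ k, Integrable (fun u => Real.exp (u ^ 2))
      (isingMagnetizationLaw (n k) (J k) (w k) : Measure ℝ) :=
    fun k => integrable_exp_sq_isingMagnetizationLaw (J k) (w k)
  set F : ℕ → ℂ → ℂ := fun k z => ∫ u, cexp (z * u) ∂(isingMagnetizationLaw (n k) (J k) (w k) : Measure ℝ)
    with hF
  set L : ℂ → ℂ := fun z => ∫ u, cexp (z * u) ∂(ν : Measure ℝ) with hL
  have hdiff : ∀ k, Differentiable ℂ (F k) := fun k => by
    have : F k = fun z => isingFieldPartition (J k) (w k) z / isingPairPartition (J k) :=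
      funext fun z => integral_exp_isingMagnetizationLaw (J k) (w k) z
    rw [this]
    exact (differentiable_isingFieldPartition (J k) (w k)).div_const _
  have hzero : ∀ k (z : ℂ), z.re ≠ 0 → F k z ≠ 0 := fun k z hz h0 =>
    hz (hasLeeYangProperty_isingMagnetizationLaw hLY (hJ k) (hw k) z h0)
  have hptw : ∀ z, Tendsto (fun k => F k z) atTop (𝓝 (L z)) :=
    fun z => tendsto_integral_cexp_of_tendsto hlim hint hC' z
  -- real points: `Re L(x) ≥ 1`
  have hreal : ∀ x : ℝ, L x ≠ 0 := by
    intro x h0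
    have h1 : Tendsto (fun k => (F k x).re) atTop (𝓝 (L x).re) :=
      (Complex.continuous_re.tendsto _).comp (hptw x)
    have h2 : 1 ≤ (L x).re :=
      ge_of_tendsto' h1 fun k => one_le_re_integral_cexp_isingMagnetizationLaw (J k) (w k) x
    rw [h0, Complex.zero_re] at h2
    exact absurd h2 (by norm_num)
  -- Hurwitz on a half plane `U` containing a real point `x`
  have key : ∀ (U : Set ℂ), IsOpen U → IsPreconnected U → (∀ z ∈ U, z.re ≠ 0) →
      ∀ x : ℝ, (x : ℂ) ∈ U → ∀ z ∈ U, L z ≠ 0 := by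
    intro U hU hU' hUre x hx
    have hloc : TendstoLocallyUniformlyOn F L atTop U :=
      tendstoLocallyUniformlyOn_integral_cexp hlim hint hC' hU
    rcases Complex.hurwitz_eqOn_zero_or_forall_ne_zero hU hU'
      (Eventually.of_forall fun k => (hdiff k).differentiableOn) hloc
      (Frequently.of_forall fun k z hz => hzero k z (hUre z hz)) with h | h
    · exact fun z _ _ => hreal x (h hx)
    · exact h
  intro z hz
  by_contra hre
  rcases lt_or_gt_of_ne hre with hlt | hgt
  · exact key {z : ℂ | z.re < 0} (isOpen_lt Complex.continuous_re continuous_const)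
      (convex_halfSpace_re_lt 0).isPreconnected (fun z hz => ne_of_lt hz) (-1) (by simp) z hlt hz
  · exact key {z : ℂ | 0 < z.re} (isOpen_lt continuous_const Complex.continuous_re)
      (convex_halfSpace_re_gt 0).isPreconnected (fun z hz => ne_of_gt hz) 1 (by simp) z hgt hz

/-- **Newman's closure theorem from the finite circle theorem alone**: combining
`lee_yang_ising_of_finite` and `hasLeeYangProperty_of_isIsingLimitLaw_of_lee_yang_ising`, the
named fact `hasLeeYangProperty_of_isIsingLimitLaw` follows from `lee_yang_circle_theorem_finite`.
[Newman 1974, Thm. 3; Lee–Yang 1952, App. II] [folklore] -/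
theorem hasLeeYangProperty_of_isIsingLimitLaw_of_finite (h : lee_yang_circle_theorem_finite) :
    hasLeeYangProperty_of_isIsingLimitLaw :=
  hasLeeYangProperty_of_isIsingLimitLaw_of_lee_yang_ising (lee_yang_ising_of_finite h)

end Literature.Probability.LatticeModels
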